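import Summits.BirchSwinnertonDyer.BirchSwinnertonDyer.Theorems.GenusKolyvaginAtTwoGenusPrimitiveSupplyAtTwoTwistingPrimeLevelFour
import HarnessLib

/-!
# Route `GenusKolyvaginAtTwo`, residual `OffCutResidualAtTwoR` (stmt-BirchSwinnertonDyer-31767), LINE 28 «visible_deep_socle» STUB N2, conjunct (HL) —
# PHANTOM LEVEL-DESCENT FOR THE LIFT OF A LEVEL-2 CLASS: `ι_{1→k} u` phantom at level `2^k` ⟹ `ι_{1→2} u` phantom at level `4`

LEAD seat `bsd-line-gk2-p1` g25 (cell `bsd-f1-sign2`), `--supports stmt-BirchSwinnertonDyer-31767 --as helper`.  THEOREMS ONLY (no definition, no named fact,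
no `sorry`).  **BSD is NOT proved by this file; nothing is closed by it alone.**

This is the `ι_*`-currency form of gk2-p4 g10's `GenusKolyTwistingPrime.forall_torsionFixing_four_h1Eval_eq_zero_of_forall_torsionFixing_pow` («entanglement is a
level-`4` phenomenon»: `H¹(GL₂(ℤ/2^k), 𝔽₂²) = H¹(GL₂(ℤ/4), 𝔽₂²)`, Lawson–Wuthrich), read through `[ι_* u, ρ] = [u, ρ]` on `Γ_{ℚ(E[n])}`.  It is EXACTLY what
turns LINE 28 N2's `ℓ₀`-VIS hypothesis (stated at level `4`) into the visibility at every level `2^{M+1}` that the (HL)-reduction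
`SocleSelection.heegnerLift_of_doorTrivial_nonPhantom_rat` (`…VisibleDeepSocleHeegnerLine`) consumes; the assembly of N2 is `…VisibleDeepSocleN2`.
* `phantom_level_descent` — the descent; * `vis_pow_of_vis_four` — VIS at level `4` ⟹ VIS at every level `2^k`, `k ≥ 2` (N2's hypothesis propagated).
BSD is NOT proved by any of this.

References: [LawsonWuthrich2016] §3 (Lemma 6, Thm. 1 at p = 2), §7.1; [SerreGaloisCohomology1997] I.§2.4; [GrossLMS1991] §9 Prop. 9.1.
-/

set_option autoImplicit false
-- the Theorems namespace of this sub repeats the summit name by design (D-0017 nested layout)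
set_option linter.dupNamespace false

noncomputable section

open scoped Classical

namespace Summit.BirchSwinnertonDyer.BirchSwinnertonDyer.Theorems.GenusExact.PlusDescent.SocleSelection

open WeierstrassCurve NumberField Field
open Literature.NumberTheory.EllipticCurves Literature.NumberTheory.GaloisRepresentations

universe u

/-- `[ι_* x, ρ] = [x, ρ]` in `E[d] ⊆ E[n]` for `ρ ∈ Γ_{K(E[n])}` (functoriality of `H¹` on cocycles; the statement and 4-line proof of
`KolyvaginAtTwo.RegularValueEngine.h1Eval_torsionH1OfDvd`, copied to keep this file's imports inside the route). [cite: SerreGaloisCohomology1997, I.§2.4] -/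
private theorem h1Eval_torsionH1OfDvd' {k' : Type u} [Field k'] (V : WeierstrassCurve k') {d n : ℤ} (h : d ∣ n)
    (x : galH1Torsion V d) {ρ : absoluteGaloisGroup k'} (hρ : ρ ∈ torsionFixing V n) :
    h1Eval V n (torsionH1OfDvd V h x) ρ = AddSubgroup.inclusion (V.geomTorsion_le_of_dvd h) (h1Eval V d x ρ) := by
  have hρd : ρ ∈ torsionFixing V d := KolyvaginLowerBoundAtTwo.torsionFixing_le_of_dvd V h hρ
  obtain ⟨φ, rfl⟩ := oneCocycleClass_surjective _ x
  rw [torsionH1OfDvd, resH1Hom_id_oneCocycleClass, h1Eval_oneCocycleClass V n _ hρ, h1Eval_oneCocycleClass V d _ hρd,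
    contOneCocycles.push_apply]

/-- **PHANTOM LEVEL-DESCENT for the lift of a level-`2` class**: for the `2`-adic tower of `E/ℚ` onto, `k ≥ 2` and `u ∈ H¹(ℚ, E[2])`, if `ι_{1→k} u` is killed
by every `ρ ∈ Γ_{ℚ(E[2^k])}` then `ι_{1→2} u` is killed by every `ρ ∈ Γ_{ℚ(E[4])}` — gk2-p4 g10's `forall_torsionFixing_four_h1Eval_eq_zero_of_forall_torsionFixing_pow`
(`H¹(GL₂(ℤ/2^k), 𝔽₂²) = H¹(GL₂(ℤ/4), 𝔽₂²)`, Lawson–Wuthrich) read through `[ι_* u, ρ] = [u, ρ]`.  BSD is NOT proved by this. [cite: LawsonWuthrich2016, §3, §7.1] -/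
theorem phantom_level_descent (W : WeierstrassCurve ℚ) [W.IsElliptic]
    (hρ : ∀ n : ℕ, 0 < n → W.HasSurjectiveModNGaloisRep ((2 : ℤ) ^ n)) {k : ℕ} (hk : 2 ≤ k) (u : galH1Torsion W 2)
    (hk1 : (2 : ℤ) ∣ ((2 ^ k : ℕ) : ℤ)) (h₁₂ : (2 : ℤ) ∣ ((2 ^ 2 : ℕ) : ℤ))
    (hph : ∀ ρ ∈ torsionFixing W ((2 ^ k : ℕ) : ℤ), h1Eval W ((2 ^ k : ℕ) : ℤ) (torsionH1OfDvd W hk1 u) ρ = 0) :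
    ∀ ρ ∈ torsionFixing W ((2 ^ 2 : ℕ) : ℤ), h1Eval W ((2 ^ 2 : ℕ) : ℤ) (torsionH1OfDvd W h₁₂ u) ρ = 0 := by
  have hx : ∀ h ∈ torsionFixing W ((2 ^ k : ℕ) : ℤ), h1Eval W (2 : ℤ) u h = 0 := fun h hh ↦ by
    have e := h1Eval_torsionH1OfDvd' W hk1 u hh
    rw [hph h hh] at e
    exact (AddSubgroup.inclusion_injective _) (by rw [map_zero]; exact e.symm)
  have h4 := GenusKolyTwistingPrime.forall_torsionFixing_four_h1Eval_eq_zero_of_forall_torsionFixing_pow W hρ hk hx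
  intro ρ hρ4
  have hρ4' : ρ ∈ torsionFixing W (4 : ℤ) := by
    have e : ((2 ^ 2 : ℕ) : ℤ) = 4 := by norm_num
    rw [e] at hρ4
    exact hρ4
  rw [h1Eval_torsionH1OfDvd' W h₁₂ u hρ4, h4 ρ hρ4', map_zero]


/-- **VIS AT LEVEL `4` ⟹ VIS AT EVERY LEVEL `2^k` (`k ≥ 2`)** for any predicate `P` on `H¹(ℚ, E[2])` (e.g. «`ℓ₀`-trivial `2`-Selmer class»): if every `u` with `P u`
whose lift `ι_{1→2} u` dies on `Γ_{ℚ(E[4])}` is `0`, then every `u` with `P u` whose lift `ι_{1→k} u` dies on `Γ_{ℚ(E[2^k])}` is `0`.  BSD is NOT proved by this.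
[cite: LawsonWuthrich2016, §3, §7.1] -/
theorem vis_pow_of_vis_four (W : WeierstrassCurve ℚ) [W.IsElliptic]
    (hρ : ∀ n : ℕ, 0 < n → W.HasSurjectiveModNGaloisRep ((2 : ℤ) ^ n)) (P : galH1Torsion W 2 → Prop)
    (hVIS : ∀ c : galH1Torsion W 2, P c →
      (∀ (h₁₂ : (2 : ℤ) ∣ ((2 ^ 2 : ℕ) : ℤ)), ∀ ρ ∈ torsionFixing W ((2 ^ 2 : ℕ) : ℤ),
        h1Eval W ((2 ^ 2 : ℕ) : ℤ) (torsionH1OfDvd W h₁₂ c) ρ = 0) → c = 0)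
    {k : ℕ} (hk : 2 ≤ k) (c : galH1Torsion W 2) (hc : P c) (hk1 : (2 : ℤ) ∣ ((2 ^ k : ℕ) : ℤ))
    (hph : ∀ ρ ∈ torsionFixing W ((2 ^ k : ℕ) : ℤ), h1Eval W ((2 ^ k : ℕ) : ℤ) (torsionH1OfDvd W hk1 c) ρ = 0) : c = 0 :=
  hVIS c hc fun h₁₂ ↦ phantom_level_descent W hρ hk c hk1 h₁₂ hph

end Summit.BirchSwinnertonDyer.BirchSwinnertonDyer.Theorems.GenusExact.PlusDescent.SocleSelection

end
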